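import Summits.MatrixMultiplication.MatrixMultiplication.Theorems.ObstructionDescentUniversalOccurrenceTwoRectangleQuadPairValue

set_option linter.dupNamespace false
set_option autoImplicit false

/-!
# Universal occurrence — two rectangles and TWO COLUMN PAIRS, part G: `((2^N),(2^N),(2N-8,4,2,2))` (decomp-mm · lens 3 · gen 43)

Route `route-MatrixMultiplication-ObstructionDescent` (sub-problem `MatrixMultiplication`, `ω(ℂ) = 2`); SUPPORT for the crux
`NoOccurrenceObstruction` (`P_O`, item `stmt-MatrixMultiplication-29040`) through the universal-occurrence programme (NODE-g29…g43
of the decomp-mm cell, lens 3).  Nothing here proves `ω = 2` or closes an item; no `def`, no `sorry`, standard axioms.  Closure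
currency as in parts I–IX: "the triple `(λ⁰,λ¹,λ²)` occurs for `s`" is `isotypicSum₁ λ⁰ (isotypicSum₂ λ¹ (isotypicSum₃ λ² (s^{⊗d}))) ≠ 0`.

**This file.**  `occurs_unitTensor_twoRectangle_fourTwoTwo`: for all `m ≥ N ≥ 6` the FOUR-row non-hook type
`((2^N),(2^N),(2N-8,4,2,2))` occurs for `⟨m⟩`, uniformly in `N` — after the hook series (parts X) and `(2N-6,4,2)` (parts A–C) the
second non-hook family in Lean.  Certificate (floor law of part IX, twist identity of the hook series, parts D–F): `M = e_T`, `T` the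
pair tableau of `(2N-8,4,2,2)`; colouring `g = (0,1,2,3,0,1,0,…)`; block structure `e = e_std ∘ (4 5)(6 7)(10 11)`; twist
`H = {s₁, s₃}`.  By part F every term of the floor-law sum is `0` or `+1`, and `quadPair_witness` exhibits a valid `σ`
(`σ₀ = (s₁ s₂)`, `σ₁ = (s₀ s₁ s₃ s₂)(s₄ s₅)`) with `g ∘ w_σ = w_T`, of value `1`.  Exact count: `52` configurations (`4` anti-twin),
`N ≥ 6` (seat data, NODE-g43 §3).

[cite: BurgisserIkenmeyer2011, §3.4 (Prop. 3.4), Thm. 4.4] [cite: BurgisserIkenmeyer2017, §5, Thm. 5.9 (proof of (2)), eq. (3.4)] [cite: Landsberg2017, §9.1.1]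
-/

noncomputable section

open scoped BigOperators

namespace Summit.MatrixMultiplication.MatrixMultiplication.Theorems.ObstructionCalculus

open Literature.Computability.AlgebraicComplexity
open Literature.NumberTheory.DiophantineGeometry

/-! ### §1 The witness term -/

set_option maxHeartbeats 400000 in
/-- **The witness.**  `σ₀ = (s₁ s₂)`, `σ₁ = (s₀ s₁ s₃ s₂)(s₄ s₅)` is valid for the twist `H = {s₁, s₃}` and `g ∘ w_σ` is the row word
of `T`, so `e_T(g ∘ w_σ) = 1 ≠ 0`. [folklore] -/
theorem quadPair_witness {N : ℕ} (hN : 6 ≤ N) {Y : YoungDiagram}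
    (hNY : ∀ x ∈ Y.cells, x.1 < N) (T : StdFilling (N * 2) Y)
    (hT : ∀ p : Fin (N * 2), T.1 p = (if (p : ℕ) < 4 then ((p : ℕ), 0) else if (p : ℕ) < 8 then ((p : ℕ) - 4, 1)
      else if (p : ℕ) < 10 then ((p : ℕ) - 8, 2) else if (p : ℕ) < 12 then ((p : ℕ) - 10, 3) else (0, (p : ℕ) - 8)))
    (e : Fin (N * 2) ≃ Fin 2 × Fin N) (g : Fin N → Fin N)
    (hgv : ∀ i : Fin N, ((g i : Fin N) : ℕ) = if (i : ℕ) ≤ 3 then (i : ℕ) else if (i : ℕ) = 5 then 1 else 0)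
    (hpos : ∀ (σ : Fin 2 → Equiv.Perm (Fin N)) (n : ℕ) (hn : n < N * 2) (a : Fin 2) (s : Fin N),
      (if n = 4 then 5 else if n = 5 then 4 else if n = 6 then 7 else if n = 7 then 6
        else if n = 10 then 11 else if n = 11 then 10 else n) % 2 = (a : ℕ) →
      (if n = 4 then 5 else if n = 5 then 4 else if n = 6 then 7 else if n = 7 then 6
        else if n = 10 then 11 else if n = 11 then 10 else n) / 2 = (s : ℕ) →
      (g ∘ fun q => σ (e q).1 (e q).2) ⟨n, hn⟩ = g (σ a s))
    (H : Finset (Fin N)) (hHv : ∀ s : Fin N, s ∈ H ↔ ((s : ℕ) = 1 ∨ (s : ℕ) = 3)) :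
    ∃ σw : Fin 2 → Equiv.Perm (Fin N), (∀ s, (σw 0)⁻¹ (σw 1 s) ∈ H ↔ s ∈ H) ∧
      T.polytabloid ℂ hNY (g ∘ fun q => σw (e q).1 (e q).2) ≠ 0 := by
  classical
  have hrowT : ∀ q : Fin (N * 2), (T.1 q).1 =
      if (q : ℕ) < 4 then (q : ℕ) else if (q : ℕ) < 8 then (q : ℕ) - 4
      else if (q : ℕ) < 10 then (q : ℕ) - 8 else if (q : ℕ) < 12 then (q : ℕ) - 10 else 0 := fun q => by
    rw [hT]; split_ifs <;> rfl
  obtain ⟨s0, hs0⟩ : ∃ s : Fin N, (s : ℕ) = 0 := ⟨⟨0, by omega⟩, rfl⟩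
  obtain ⟨s1, hs1⟩ : ∃ s : Fin N, (s : ℕ) = 1 := ⟨⟨1, by omega⟩, rfl⟩
  obtain ⟨s2, hs2⟩ : ∃ s : Fin N, (s : ℕ) = 2 := ⟨⟨2, by omega⟩, rfl⟩
  obtain ⟨s3, hs3⟩ : ∃ s : Fin N, (s : ℕ) = 3 := ⟨⟨3, by omega⟩, rfl⟩
  obtain ⟨s4, hs4⟩ : ∃ s : Fin N, (s : ℕ) = 4 := ⟨⟨4, by omega⟩, rfl⟩
  obtain ⟨s5, hs5⟩ : ∃ s : Fin N, (s : ℕ) = 5 := ⟨⟨5, by omega⟩, rfl⟩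
  obtain ⟨σw, hw0, hw1⟩ : ∃ σw : Fin 2 → Equiv.Perm (Fin N), σw 0 = Equiv.swap s1 s2 ∧
      σw 1 = Equiv.swap s0 s1 * Equiv.swap s1 s3 * Equiv.swap s3 s2 * Equiv.swap s4 s5 :=
    ⟨![Equiv.swap s1 s2, Equiv.swap s0 s1 * Equiv.swap s1 s3 * Equiv.swap s3 s2 * Equiv.swap s4 s5], rfl, rfl⟩
  refine ⟨σw, ?_⟩
  have hsw0 : ∀ s : Fin N, ((σw 0 s : Fin N) : ℕ) =
      if (s : ℕ) = 1 then 2 else if (s : ℕ) = 2 then 1 else (s : ℕ) := by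
    intro s
    rw [hw0, Equiv.swap_apply_def]
    simp only [Fin.ext_iff, hs1, hs2]
    split_ifs <;> omega
  have hL : ∀ x : Fin N, ((((Equiv.swap s0 s1 * Equiv.swap s1 s3) x) : Fin N) : ℕ) =
      if (x : ℕ) = 0 then 1 else if (x : ℕ) = 1 then 3 else if (x : ℕ) = 3 then 0 else (x : ℕ) := by
    intro x
    rw [Equiv.Perm.mul_apply, Equiv.swap_apply_def, Equiv.swap_apply_def]
    simp only [Fin.ext_iff, hs0, hs1, hs3]
    split_ifs <;> omega
  have hR : ∀ x : Fin N, ((((Equiv.swap s3 s2 * Equiv.swap s4 s5) x) : Fin N) : ℕ) =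
      if (x : ℕ) = 3 then 2 else if (x : ℕ) = 2 then 3 else if (x : ℕ) = 4 then 5 else if (x : ℕ) = 5 then 4
      else (x : ℕ) := by
    intro x
    rw [Equiv.Perm.mul_apply, Equiv.swap_apply_def, Equiv.swap_apply_def]
    simp only [Fin.ext_iff, hs2, hs3, hs4, hs5]
    split_ifs <;> omega
  have hsw1 : ∀ s : Fin N, ((σw 1 s : Fin N) : ℕ) =
      if (s : ℕ) = 0 then 1 else if (s : ℕ) = 1 then 3 else if (s : ℕ) = 2 then 0
      else if (s : ℕ) = 3 then 2 else if (s : ℕ) = 4 then 5 else if (s : ℕ) = 5 then 4 else (s : ℕ) := by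
    intro s
    have hRs := hR s
    rw [hw1, show Equiv.swap s0 s1 * Equiv.swap s1 s3 * Equiv.swap s3 s2 * Equiv.swap s4 s5 =
      (Equiv.swap s0 s1 * Equiv.swap s1 s3) * (Equiv.swap s3 s2 * Equiv.swap s4 s5) from by simp only [mul_assoc],
      Equiv.Perm.mul_apply, hL]
    generalize (((Equiv.swap s3 s2 * Equiv.swap s4 s5) s : Fin N) : ℕ) = r at hRs ⊢
    split_ifs at hRs ⊢ <;> omega
  constructor
  · -- validity
    intro s
    have hi0 : ∀ x, σw 0 ((σw 0)⁻¹ x) = x := fun x => (σw 0).apply_symm_apply x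
    set t := (σw 0)⁻¹ (σw 1 s) with ht
    have h1 : ((σw 0 t : Fin N) : ℕ) = ((σw 1 s : Fin N) : ℕ) := by rw [ht, hi0]
    rw [hsw0, hsw1] at h1
    rw [hHv, hHv]
    split_ifs at h1 <;> omega
  · -- `g ∘ w_σ = w_T`
    have hwrd : (g ∘ fun q => σw (e q).1 (e q).2) = StdFilling.rowWord hNY T := by
      funext q
      obtain ⟨n, hn⟩ := q
      apply Fin.ext
      show _ = (T.1 ⟨n, hn⟩).1
      rw [hrowT]
      dsimp only
      by_cases hn12 : n < 12
      · have hcases : n = 0 ∨ n = 1 ∨ n = 2 ∨ n = 3 ∨ n = 4 ∨ n = 5 ∨ n = 6 ∨ n = 7 ∨ n = 8 ∨ n = 9 ∨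
            n = 10 ∨ n = 11 := by omega
        rcases hcases with rfl | rfl | rfl | rfl | rfl | rfl | rfl | rfl | rfl | rfl | rfl | rfl
        · rw [hpos σw 0 hn 0 s0 (by norm_num) (by norm_num [hs0]), hgv, hsw0]; simp [hs0]
        · rw [hpos σw 1 hn 1 s0 (by norm_num) (by norm_num [hs0]), hgv, hsw1]; simp [hs0]
        · rw [hpos σw 2 hn 0 s1 (by norm_num) (by norm_num [hs1]), hgv, hsw0]; simp [hs1]
        · rw [hpos σw 3 hn 1 s1 (by norm_num) (by norm_num [hs1]), hgv, hsw1]; simp [hs1]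
        · rw [hpos σw 4 hn 1 s2 (by norm_num) (by norm_num [hs2]), hgv, hsw1]; simp [hs2]
        · rw [hpos σw 5 hn 0 s2 (by norm_num) (by norm_num [hs2]), hgv, hsw0]; simp [hs2]
        · rw [hpos σw 6 hn 1 s3 (by norm_num) (by norm_num [hs3]), hgv, hsw1]; simp [hs3]
        · rw [hpos σw 7 hn 0 s3 (by norm_num) (by norm_num [hs3]), hgv, hsw0]; simp [hs3]
        · rw [hpos σw 8 hn 0 s4 (by norm_num) (by norm_num [hs4]), hgv, hsw0]; simp [hs4]
        · rw [hpos σw 9 hn 1 s4 (by norm_num) (by norm_num [hs4]), hgv, hsw1]; simp [hs4]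
        · rw [hpos σw 10 hn 1 s5 (by norm_num) (by norm_num [hs5]), hgv, hsw1]; simp [hs5]
        · rw [hpos σw 11 hn 0 s5 (by norm_num) (by norm_num [hs5]), hgv, hsw0]; simp [hs5]
      · -- arm
        have ha : (if n = 4 then 5 else if n = 5 then 4 else if n = 6 then 7 else if n = 7 then 6
            else if n = 10 then 11 else if n = 11 then 10 else n) % 2 = (((⟨n % 2, by omega⟩ : Fin 2) : Fin 2) : ℕ) := by
          dsimp only; split_ifs <;> omega
        have hs : (if n = 4 then 5 else if n = 5 then 4 else if n = 6 then 7 else if n = 7 then 6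
            else if n = 10 then 11 else if n = 11 then 10 else n) / 2 = (((⟨n / 2, by omega⟩ : Fin N) : Fin N) : ℕ) := by
          dsimp only; split_ifs <;> omega
        rw [hpos σw n hn ⟨n % 2, by omega⟩ ⟨n / 2, by omega⟩ ha hs, hgv]
        have hfix : ((σw ⟨n % 2, by omega⟩ ⟨n / 2, by omega⟩ : Fin N) : ℕ) = n / 2 := by
          have : (⟨n % 2, by omega⟩ : Fin 2) = 0 ∨ (⟨n % 2, by omega⟩ : Fin 2) = 1 := by
            rcases Nat.mod_two_eq_zero_or_one n with h | h
            · left; exact Fin.ext h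
            · right; exact Fin.ext h
          rcases this with h | h
          · rw [h, hsw0]; dsimp only; split_ifs <;> omega
          · rw [h, hsw1]; dsimp only; split_ifs <;> omega
        rw [hfix]
        split_ifs <;> omega
    rw [hwrd, StdFilling.polytabloid_apply_rowWord]
    exact one_ne_zero

/-! ### §2 The certificate for `ν = (2N-8, 4, 2, 2)` -/

set_option maxHeartbeats 400000 in
/-- **`((2^N),(2^N),(2N-8,4,2,2))` occurs for `⟨m⟩` for all `m ≥ N ≥ 6`** — a four-row non-hook type on the third leg, uniformly
in `N`. [cite: BurgisserIkenmeyer2011, Thm. 4.4] [cite: BurgisserIkenmeyer2017, Thm. 5.9 (proof of (2))] -/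
theorem occurs_unitTensor_twoRectangle_fourTwoTwo {N m : ℕ} (hN : 6 ≤ N) (hNm : N ≤ m)
    {lam : Fin 3 → Nat.Partition (N * 2)} (h0 : lam 0 = Nat.Partition.rectangle N 2)
    (h1 : lam 1 = Nat.Partition.rectangle N 2) (h2 : (lam 2).sortedParts = [2 * N - 8, 4, 2, 2]) :
    isotypicSum₁ (lam 0) (isotypicSum₂ (lam 1) (isotypicSum₃ (lam 2)
      (kroneckerPow (unitTensor ℂ m) (N * 2)))) ≠ 0 := by
  classical
  -- the shape and the pair tableau `T`
  have hNY : ∀ x ∈ (lam 2).youngDiagram.cells, x.1 < N := fun x hx => by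
    have := fst_lt_of_mem_youngDiagram_fourTwoTwo (lam 2) h2 hx; omega
  have hd : (lam 2).youngDiagram.cells.card = N * 2 := Nat.Partition.card_cells_youngDiagram _
  obtain ⟨T, hT⟩ : ∃ T : StdFilling (N * 2) (lam 2).youngDiagram, ∀ p : Fin (N * 2), T.1 p =
      (if (p : ℕ) < 4 then ((p : ℕ), 0) else if (p : ℕ) < 8 then ((p : ℕ) - 4, 1)
        else if (p : ℕ) < 10 then ((p : ℕ) - 8, 2) else if (p : ℕ) < 12 then ((p : ℕ) - 10, 3) else (0, (p : ℕ) - 8)) :=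
    ⟨⟨fun p => if (p : ℕ) < 4 then ((p : ℕ), 0) else if (p : ℕ) < 8 then ((p : ℕ) - 4, 1)
        else if (p : ℕ) < 10 then ((p : ℕ) - 8, 2) else if (p : ℕ) < 12 then ((p : ℕ) - 10, 3) else (0, (p : ℕ) - 8),
      ⟨fun p => quadPairCell_mem_fourTwoTwo hN (lam 2) h2 p p.2,
       fun p q hpq => Fin.ext (quadPairCell_injective hpq),
       fun p q hpq => quadPairCell_standard hpq⟩⟩, fun p => rfl⟩
  have hM : StdFilling.polytabloid ℂ hNY T ∈
      highestWeightSpace (wordRep ℂ N (N * 2)) (Weight.ofPartition N (lam 2)) := by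
    rw [← ydWeight_youngDiagram]; exact StdFilling.polytabloid_mem hNY T hd
  -- the slots, the positions and the block structures
  obtain ⟨s0, hs0⟩ : ∃ s : Fin N, (s : ℕ) = 0 := ⟨⟨0, by omega⟩, rfl⟩
  obtain ⟨s1, hs1⟩ : ∃ s : Fin N, (s : ℕ) = 1 := ⟨⟨1, by omega⟩, rfl⟩
  obtain ⟨s3, hs3⟩ : ∃ s : Fin N, (s : ℕ) = 3 := ⟨⟨3, by omega⟩, rfl⟩
  obtain ⟨p4, hp4⟩ : ∃ p : Fin (N * 2), (p : ℕ) = 4 := ⟨⟨4, by omega⟩, rfl⟩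
  obtain ⟨p5, hp5⟩ : ∃ p : Fin (N * 2), (p : ℕ) = 5 := ⟨⟨5, by omega⟩, rfl⟩
  obtain ⟨p6, hp6⟩ : ∃ p : Fin (N * 2), (p : ℕ) = 6 := ⟨⟨6, by omega⟩, rfl⟩
  obtain ⟨p7, hp7⟩ : ∃ p : Fin (N * 2), (p : ℕ) = 7 := ⟨⟨7, by omega⟩, rfl⟩
  obtain ⟨p10, hp10⟩ : ∃ p : Fin (N * 2), (p : ℕ) = 10 := ⟨⟨10, by omega⟩, rfl⟩
  obtain ⟨p11, hp11⟩ : ∃ p : Fin (N * 2), (p : ℕ) = 11 := ⟨⟨11, by omega⟩, rfl⟩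
  obtain ⟨ξ, hξ⟩ : ∃ ξ : Equiv.Perm (Fin (N * 2)),
      ξ = Equiv.swap p4 p5 * Equiv.swap p6 p7 * Equiv.swap p10 p11 := ⟨_, rfl⟩
  have hξv : ∀ q : Fin (N * 2), ((ξ q : Fin (N * 2)) : ℕ) =
      if (q : ℕ) = 4 then 5 else if (q : ℕ) = 5 then 4 else if (q : ℕ) = 6 then 7 else if (q : ℕ) = 7 then 6
      else if (q : ℕ) = 10 then 11 else if (q : ℕ) = 11 then 10 else (q : ℕ) := by
    intro q
    rw [hξ, Equiv.Perm.mul_apply, Equiv.Perm.mul_apply, Equiv.swap_apply_def, Equiv.swap_apply_def,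
      Equiv.swap_apply_def]
    simp only [Fin.ext_iff, hp4, hp5, hp6, hp7, hp10, hp11]
    split_ifs <;> omega
  obtain ⟨e, he⟩ : ∃ e : Fin (N * 2) ≃ Fin 2 × Fin N,
      e = ξ.trans (finProdFinEquiv.symm.trans (Equiv.prodComm (Fin N) (Fin 2))) := ⟨_, rfl⟩
  have hev : ∀ q : Fin (N * 2), (((e q).1 : Fin 2) : ℕ) = ((ξ q : Fin (N * 2)) : ℕ) % 2 ∧
      (((e q).2 : Fin N) : ℕ) = ((ξ q : Fin (N * 2)) : ℕ) / 2 := by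
    intro q; rw [he]; simp [Fin.modNat, Fin.divNat]
  obtain ⟨H, hH⟩ : ∃ H : Finset (Fin N), H = {s1, s3} := ⟨_, rfl⟩
  have hHv : ∀ s : Fin N, s ∈ H ↔ ((s : ℕ) = 1 ∨ (s : ℕ) = 3) := by
    intro s; rw [hH, Finset.mem_insert, Finset.mem_singleton, Fin.ext_iff, Fin.ext_iff, hs1, hs3]
  let F : Fin 2 × Fin N → Fin 2 × Fin N := fun x => (if x.2 ∈ H then Fin.rev x.1 else x.1, x.2)
  have hF : Function.Involutive F := by
    rintro ⟨a, s⟩; by_cases hs : s ∈ H <;> simp [F, hs, Fin.rev_rev]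
  obtain ⟨e', he'⟩ : ∃ e' : Fin (N * 2) ≃ Fin 2 × Fin N,
      ∀ q, e' q = (if (e q).2 ∈ H then Fin.rev (e q).1 else (e q).1, (e q).2) :=
    ⟨e.trans (Function.Involutive.toPerm F hF), fun q => rfl⟩
  -- the colouring `g = (0,1,2,3,0,1,0,0,…)`
  obtain ⟨g, hg⟩ : ∃ g : Fin N → Fin N, ∀ i, g i =
      if (i : ℕ) ≤ 3 then i else if (i : ℕ) = 5 then s1 else s0 := ⟨_, fun i => rfl⟩
  have hgv : ∀ i : Fin N, ((g i : Fin N) : ℕ) =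
      if (i : ℕ) ≤ 3 then (i : ℕ) else if (i : ℕ) = 5 then 1 else 0 := by
    intro i; rw [hg]; split_ifs <;> omega
  -- evaluation of the words `g ∘ w_σ` at the positions
  have hpos : ∀ (σ : Fin 2 → Equiv.Perm (Fin N)) (n : ℕ) (hn : n < N * 2) (a : Fin 2) (s : Fin N),
      (if n = 4 then 5 else if n = 5 then 4 else if n = 6 then 7 else if n = 7 then 6
        else if n = 10 then 11 else if n = 11 then 10 else n) % 2 = (a : ℕ) →
      (if n = 4 then 5 else if n = 5 then 4 else if n = 6 then 7 else if n = 7 then 6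
        else if n = 10 then 11 else if n = 11 then 10 else n) / 2 = (s : ℕ) →
      (g ∘ fun q => σ (e q).1 (e q).2) ⟨n, hn⟩ = g (σ a s) := by
    intro σ n hn a s ha hs
    obtain ⟨h1, h2⟩ := hev ⟨n, hn⟩
    rw [hξv] at h1 h2
    dsimp only at h1 h2
    have ha' : (e ⟨n, hn⟩).1 = a := Fin.ext (by rw [h1, ha])
    have hs' : (e ⟨n, hn⟩).2 = s := Fin.ext (by rw [h2, hs])
    show g (σ (e ⟨n, hn⟩).1 (e ⟨n, hn⟩).2) = _
    rw [ha', hs']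
  -- the summands are `0` or `1`
  have hterm : ∀ σ : Fin 2 → Equiv.Perm (Fin N),
      (∏ a, ((Equiv.Perm.sign (σ a) : ℤ) : ℂ)) *
          (wordBlockSign ℂ e' (fun q => σ (e q).1 (e q).2) *
            ∑ w, StdFilling.polytabloid ℂ hNY T w *
              ∏ q, (fun i l : Fin N => if l = g i then (1 : ℂ) else 0) (σ (e q).1 (e q).2) (w q)) =
        if (∀ s, (σ 0)⁻¹ (σ 1 s) ∈ H ↔ s ∈ H) ∧
            StdFilling.polytabloid ℂ hNY T (g ∘ fun q => σ (e q).1 (e q).2) ≠ 0 then 1 else 0 := by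
    intro σ
    have hc : (∑ w, StdFilling.polytabloid ℂ hNY T w *
        ∏ q, (fun i l : Fin N => if l = g i then (1 : ℂ) else 0) (σ (e q).1 (e q).2) (w q)) =
        StdFilling.polytabloid ℂ hNY T (g ∘ fun q => σ (e q).1 (e q).2) :=
      sum_mul_prod_indicator_eq _ g _
    rw [hc, ← mul_assoc, sign_mul_wordBlockSign_twist e e' H he' σ]
    by_cases hval : ∀ s, (σ 0)⁻¹ (σ 1 s) ∈ H ↔ s ∈ H
    · rw [if_pos hval, one_mul]
      by_cases hz : StdFilling.polytabloid ℂ hNY T (g ∘ fun q => σ (e q).1 (e q).2) = 0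
      · rw [if_neg (fun h => h.2 hz), hz]
      · rw [if_pos ⟨hval, hz⟩]
        exact quadPair_value_eq_one hN hNY T hT e g hgv hpos H hHv σ hval hz
    · rw [if_neg hval, zero_mul, if_neg (fun h => hval h.1)]
  refine occurs_unitTensor_twoRectangle_of_pairing_ne_zero hNm e e' h0 h1 hM
    (fun i l => if l = g i then (1 : ℂ) else 0) ?_
  intro hsum
  rw [Finset.sum_congr rfl (fun σ _ => hterm σ), Finset.sum_boole, Nat.cast_eq_zero,
    Finset.card_eq_zero, Finset.filter_eq_empty_iff] at hsum
  obtain ⟨σw, hv, hne⟩ := quadPair_witness hN hNY T hT e g hgv hpos H hHv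
  exact hsum (Finset.mem_univ σw) ⟨hv, hne⟩

end Summit.MatrixMultiplication.MatrixMultiplication.Theorems.ObstructionCalculus
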